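import Mathlib

/-!
# Route `UniversalDetector`, support item `LimitExtraction` (stmt-QuantumFields-26597): Arzelà–Ascoli across shrinking meshes

Ideator seat ym-idea-8 g4.  Pure-analysis support lemma for the compactness half of `LimitExtraction`
(`Summit.QuantumFields.YangMills.Theses.UniversalDetector.LimitExtraction`): its hypothesis (TIGHT) bounds the
rescaled lattice two-point kernels `ker β L` and gives them a modulus of continuity `ω_η → 0` (at `0⁺`) on every
exterior region `{η ≤ ‖a z‖}`, uniformly for `β ≥ β₅`, `a(β) L ≥ Λ₅`; its first conclusions ask for a subsequence
`φ` and a kernel `K : ℝ⁴ → ℝ`, continuous off `0` and bounded on exterior regions, with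
`|ker_{φ k} z - K (a_{φ k} z)| ≤ ε` uniformly over the lattice points of every annulus `{η ≤ ‖a z‖ ≤ η⁻¹}`.

`meshArzelaAscoli` proves exactly this extraction for abstract meshes `S k ⊆ ℝᵈ` that become dense in every ball
(`hD`; for `LimitExtraction`: mesh `a(β_k) → 0` and physical size `a(β_k) L_k → ∞` of the centred boxes) and
functions `f k` satisfying the (TIGHT)-shaped hypothesis `hT`; `meshArzelaAscoli_indexed` is the same statement with
the meshes presented as injective images `e k '' P k` of index sets and indexed values `g k i` — the binder shape of
`LimitExtraction` (`i = z ∈ box 4 L`, `e k z = a • siteToE z`, `g k z = ker β L z`).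

Proof: a diagonal subsequence making the (clamped) values at mesh points nearest to a countable dense set converge
(compactness of `Π_n [-B_n, B_n]` in `ℕ → ℝ`); the mesh modulus makes the reference sequences
`k ↦ f (φ k) (z_k(x))` (nearest mesh point to `x`) locally uniformly close, hence Cauchy; `K x` is their limit;
continuity, boundedness and the uniform approximation on annuli (finite `δ`-net of the compact annulus) follow from
the same modulus.  The remaining conclusions of `LimitExtraction` (symmetries of `K`, reflection positivity,
convergence of `Q2` as Riemann sums) are lattice-gauge specific and not addressed here.  No summit, leg or spine
statement is proved here.
-/

set_option autoImplicit false

namespace Summit.QuantumFields.YangMills.Cruxes.UniversalDetectorLimitExtraction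

open Filter Topology Set Metric

/-! ### Part A: generic real-analysis helpers -/

/-- From a modulus `ω → 0` at `0⁺` valid for `k ≥ k₀` to an `ε`–`δ` statement uniform in `k ≥ k₀`. -/
private lemma modulus_uniform {E : Type*} [NormedAddCommGroup E] (S : ℕ → Set E) (f : ℕ → E → ℝ)
    (η : ℝ) (ω : ℝ → ℝ) (k₀ : ℕ) (hω : Tendsto ω (𝓝[>] 0) (𝓝 0))
    (hk : ∀ k, k₀ ≤ k → ∀ z ∈ S k, ∀ z' ∈ S k, η ≤ ‖z‖ → η ≤ ‖z'‖ → |f k z - f k z'| ≤ ω ‖z - z'‖)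
    (ε : ℝ) (hε : 0 < ε) :
    ∃ δ : ℝ, 0 < δ ∧ ∀ k, k₀ ≤ k → ∀ z ∈ S k, ∀ z' ∈ S k, η ≤ ‖z‖ → η ≤ ‖z'‖ → ‖z - z'‖ < δ →
      |f k z - f k z'| ≤ ε := by
  obtain ⟨δ, hδ, hh⟩ := Metric.tendsto_nhdsWithin_nhds.mp hω ε hε
  refine ⟨δ, hδ, fun k hk0 z hz z' hz' hzn hz'n hdist => ?_⟩
  by_cases heq : z = z'
  · subst heq; simp [hε.le]
  · have hpos : 0 < ‖z - z'‖ := norm_pos_iff.mpr (sub_ne_zero.mpr heq)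
    have h1 := hh (x := ‖z - z'‖) hpos (by rwa [dist_zero_right, norm_norm])
    rw [Real.dist_eq, sub_zero] at h1
    exact (hk k hk0 z hz z' hz' hzn hz'n).trans ((le_abs_self _).trans h1.le)

/-- A real sequence which, for every `ε > 0`, is eventually `ε`-close to some convergent sequence is Cauchy. -/
private lemma cauchySeq_of_near_convergent (u : ℕ → ℝ)
    (h : ∀ ε : ℝ, 0 < ε → ∃ (v : ℕ → ℝ) (b : ℝ), Tendsto v atTop (𝓝 b) ∧ ∀ᶠ k in atTop, |u k - v k| ≤ ε) :
    CauchySeq u := by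
  refine Metric.cauchySeq_iff.mpr fun ε hε => ?_
  obtain ⟨v, b, hv, hcl⟩ := h (ε / 4) (by positivity)
  have hv' : ∀ᶠ k in atTop, |v k - b| < ε / 4 := by
    have := (Metric.tendsto_nhds.mp hv) (ε / 4) (by positivity)
    exact this.mono fun k hk => by rwa [Real.dist_eq] at hk
  obtain ⟨N, hN⟩ := (hcl.and hv').exists_forall_of_atTop
  refine ⟨N, fun m hm n hn => ?_⟩
  obtain ⟨hm1, hm2⟩ := hN m hm
  obtain ⟨hn1, hn2⟩ := hN n hn
  rw [Real.dist_eq]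
  calc |u m - u n| = |(u m - v m) + (v m - b) - ((u n - v n) + (v n - b))| := by ring_nf
    _ ≤ |(u m - v m) + (v m - b)| + |(u n - v n) + (v n - b)| := abs_sub _ _
    _ ≤ (|u m - v m| + |v m - b|) + (|u n - v n| + |v n - b|) := add_le_add (abs_add_le _ _) (abs_add_le _ _)
    _ < ε := by linarith

/-- Limits of sequences that are eventually `ε`-close are `ε`-close. -/
private lemma abs_sub_le_of_tendsto (u v : ℕ → ℝ) (a b ε : ℝ) (hu : Tendsto u atTop (𝓝 a))
    (hv : Tendsto v atTop (𝓝 b)) (h : ∀ᶠ k in atTop, |u k - v k| ≤ ε) : |a - b| ≤ ε :=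
  le_of_tendsto ((continuous_abs.tendsto _).comp (hu.sub hv)) h

/-- Limits of eventually bounded sequences are bounded. -/
private lemma abs_le_of_tendsto (u : ℕ → ℝ) (a C : ℝ) (hu : Tendsto u atTop (𝓝 a))
    (h : ∀ᶠ k in atTop, |u k| ≤ C) : |a| ≤ C :=
  le_of_tendsto ((continuous_abs.tendsto _).comp hu) h

/-- A diagonal subsequence along which countably many clamped real sequences all converge. -/
private lemma exists_diagonal_subseq (g : ℕ → ℕ → ℝ) (B : ℕ → ℝ) (hg : ∀ k n, |g k n| ≤ B n) :
    ∃ (φ : ℕ → ℕ) (G : ℕ → ℝ), StrictMono φ ∧ ∀ n, Tendsto (fun k => g (φ k) n) atTop (𝓝 (G n)) := by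
  have hc : IsCompact (Set.pi Set.univ fun n : ℕ => Set.Icc (-B n) (B n)) :=
    isCompact_univ_pi fun _ => isCompact_Icc
  have hmem : ∀ k, g k ∈ Set.pi Set.univ fun n : ℕ => Set.Icc (-B n) (B n) :=
    fun k => fun n _ => abs_le.mp (hg k n)
  obtain ⟨G, -, φ, hφ, hlim⟩ := hc.tendsto_subseq hmem
  exact ⟨φ, G, hφ, fun n => (tendsto_pi_nhds.mp hlim) n⟩

/-! ### Part B: Arzelà–Ascoli across shrinking meshes -/

/-- **Arzelà–Ascoli across shrinking meshes (diagonal extraction).**  Let `S k ⊆ ℝᵈ` be "meshes" that become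
dense in every ball (`hD`) and `f k` functions which, on every exterior region `{η ≤ ‖z‖}` and for `k` large, are
uniformly bounded and uniformly equicontinuous ALONG THE MESH with a modulus `ω_η → 0` at `0⁺` (`hT`, the shape of
the tightness hypothesis of `LimitExtraction`).  Then along a subsequence `φ` the `f (φ k)` converge, uniformly on the
mesh points of every annulus `{η ≤ ‖z‖ ≤ η⁻¹}`, to a function `K` continuous off the origin and bounded on every
exterior region.  (Pure analysis support lemma for the support item `LimitExtraction` of route `UniversalDetector`;
no lattice gauge theory enters.) -/
theorem meshArzelaAscoli (d : ℕ) (S : ℕ → Set (EuclideanSpace ℝ (Fin d)))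
    (f : ℕ → EuclideanSpace ℝ (Fin d) → ℝ)
    (hT : ∀ η : ℝ, 0 < η → ∃ (C : ℝ) (ω : ℝ → ℝ) (k₀ : ℕ), Tendsto ω (𝓝[>] 0) (𝓝 0) ∧
      ∀ k, k₀ ≤ k → ∀ z ∈ S k, η ≤ ‖z‖ →
        |f k z| ≤ C ∧ ∀ z' ∈ S k, η ≤ ‖z'‖ → |f k z - f k z'| ≤ ω ‖z - z'‖)
    (hD : ∀ δ R : ℝ, 0 < δ → 0 < R → ∃ k₀ : ℕ, ∀ k, k₀ ≤ k →
      ∀ x : EuclideanSpace ℝ (Fin d), ‖x‖ ≤ R → ∃ z ∈ S k, ‖x - z‖ ≤ δ) :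
    ∃ (φ : ℕ → ℕ) (K : EuclideanSpace ℝ (Fin d) → ℝ), StrictMono φ ∧
      (∀ η ε : ℝ, 0 < η → 0 < ε → ∃ k₀ : ℕ, ∀ k, k₀ ≤ k → ∀ z ∈ S (φ k), η ≤ ‖z‖ → ‖z‖ ≤ η⁻¹ →
        |f (φ k) z - K z| ≤ ε) ∧
      ContinuousOn K {z | z ≠ 0} ∧
      (∀ η : ℝ, 0 < η → ∃ C : ℝ, ∀ z : EuclideanSpace ℝ (Fin d), η ≤ ‖z‖ → |K z| ≤ C) := by
  -- choice functions for the tightness data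
  choose! Cf ωf k0f hωf hTf using hT
  -- near-point selectors into the meshes
  have hz : ∀ (k : ℕ) (x : EuclideanSpace ℝ (Fin d)), ∃ z : EuclideanSpace ℝ (Fin d),
      (S k).Nonempty → z ∈ S k ∧ dist x z < infDist x (S k) + 1 / ((k : ℝ) + 1) := by
    intro k x
    by_cases hne : (S k).Nonempty
    · have hpos : (0 : ℝ) < 1 / ((k : ℝ) + 1) := by positivity
      obtain ⟨z, hzS, hzd⟩ := (infDist_lt_iff hne).mp (lt_add_of_pos_right (infDist x (S k)) hpos)
      exact ⟨z, fun _ => ⟨hzS, hzd⟩⟩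
    · exact ⟨x, fun h => absurd h hne⟩
  choose zf hzf using hz
  have hnear : ∀ (x : EuclideanSpace ℝ (Fin d)) (δ : ℝ), 0 < δ →
      ∃ k₁ : ℕ, ∀ k, k₁ ≤ k → zf k x ∈ S k ∧ ‖x - zf k x‖ < δ := by
    intro x δ hδ
    obtain ⟨k₀, hk₀⟩ := hD (δ / 2) (max ‖x‖ 1) (by positivity) (by positivity)
    obtain ⟨k₁, hk₁⟩ := exists_nat_one_div_lt (by positivity : 0 < δ / 2)
    refine ⟨max k₀ k₁, fun k hk => ?_⟩
    obtain ⟨z, hzS, hzx⟩ := hk₀ k ((le_max_left _ _).trans hk) x (le_max_left _ _)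
    obtain ⟨hmem, hdist⟩ := hzf k x ⟨z, hzS⟩
    refine ⟨hmem, ?_⟩
    have h1 : infDist x (S k) ≤ δ / 2 := (infDist_le_dist_of_mem hzS).trans (by rwa [dist_eq_norm])
    have h2 : 1 / ((k : ℝ) + 1) ≤ 1 / ((k₁ : ℝ) + 1) := by
      gcongr; exact_mod_cast (le_max_right _ _).trans hk
    rw [← dist_eq_norm]; linarith
  -- a dense sequence and the clamped diagonal data
  obtain ⟨dseq, hdense⟩ := TopologicalSpace.exists_dense_seq (EuclideanSpace ℝ (Fin d))
  obtain ⟨φ, G, hφ, hG⟩ := exists_diagonal_subseq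
    (fun k n => max (-(|Cf (‖dseq n‖ / 2)| + 1)) (min (|Cf (‖dseq n‖ / 2)| + 1) (f k (zf k (dseq n)))))
    (fun n => |Cf (‖dseq n‖ / 2)| + 1) (by
      intro k n
      have hBpos : 0 ≤ |Cf (‖dseq n‖ / 2)| + 1 := by positivity
      rw [abs_le]
      exact ⟨le_max_left _ _, max_le (by linarith) (min_le_left _ _)⟩)
  have hφk : ∀ k, k ≤ φ k := fun k => hφ.id_le k
  -- along the dense sequence (off the origin) the unclamped values converge
  have hGn : ∀ n, dseq n ≠ 0 → Tendsto (fun k => f (φ k) (zf (φ k) (dseq n))) atTop (𝓝 (G n)) := by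
    intro n hn
    have hη : 0 < ‖dseq n‖ / 2 := by positivity
    obtain ⟨k₁, hk₁⟩ := hnear (dseq n) (‖dseq n‖ / 2) hη
    refine (hG n).congr' ?_
    filter_upwards [eventually_ge_atTop (max k₁ (k0f (‖dseq n‖ / 2)))] with k hk
    obtain ⟨hmem, hdist⟩ := hk₁ (φ k) (((le_max_left _ _).trans hk).trans (hφk k))
    have hnorm : ‖dseq n‖ / 2 ≤ ‖zf (φ k) (dseq n)‖ := by
      have := norm_sub_norm_le (dseq n) (zf (φ k) (dseq n)); linarith
    have hb : |f (φ k) (zf (φ k) (dseq n))| ≤ Cf (‖dseq n‖ / 2) :=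
      ((hTf _ hη) (φ k) (((le_max_right _ _).trans hk).trans (hφk k)) _ hmem hnorm).1
    have hb' := abs_le.mp (hb.trans (le_abs_self _))
    rw [min_eq_right (by linarith), max_eq_right (by linarith)]
  -- uniform modulus along the subsequence
  have hU : ∀ η : ℝ, 0 < η → ∀ ε : ℝ, 0 < ε → ∃ δ : ℝ, 0 < δ ∧ ∀ k, k0f η ≤ k →
      ∀ z ∈ S (φ k), ∀ z' ∈ S (φ k), η ≤ ‖z‖ → η ≤ ‖z'‖ → ‖z - z'‖ < δ → |f (φ k) z - f (φ k) z'| ≤ ε := by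
    intro η hη ε hε
    obtain ⟨δ, hδ, h⟩ := modulus_uniform S f η (ωf η) (k0f η) (hωf η hη)
      (fun k hk z hz z' hz' hzn hz'n => ((hTf η hη) k hk z hz hzn).2 z' hz' hz'n) ε hε
    exact ⟨δ, hδ, fun k hk z hz z' hz' hzn hz'n hd => h (φ k) (hk.trans (hφk k)) z hz z' hz' hzn hz'n hd⟩
  have hnearφ : ∀ (x : EuclideanSpace ℝ (Fin d)) (δ : ℝ), 0 < δ →
      ∀ᶠ k in atTop, zf (φ k) x ∈ S (φ k) ∧ ‖x - zf (φ k) x‖ < δ := by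
    intro x δ hδ
    obtain ⟨k₁, hk₁⟩ := hnear x δ hδ
    filter_upwards [eventually_ge_atTop k₁] with k hk using hk₁ (φ k) (hk.trans (hφk k))
  -- the reference sequences `u x k = f (φ k) (zf (φ k) x)` are locally uniformly close
  have hkey : ∀ x : EuclideanSpace ℝ (Fin d), x ≠ 0 → ∀ ε : ℝ, 0 < ε → ∃ δ : ℝ, 0 < δ ∧
      ∀ y : EuclideanSpace ℝ (Fin d), ‖y - x‖ < δ →
        ∀ᶠ k in atTop, |f (φ k) (zf (φ k) y) - f (φ k) (zf (φ k) x)| ≤ ε := by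
    intro x hx ε hε
    have hxpos : 0 < ‖x‖ := norm_pos_iff.mpr hx
    obtain ⟨δ₀, hδ₀, hU₀⟩ := hU (‖x‖ / 2) (by positivity) ε hε
    refine ⟨min (δ₀ / 3) (‖x‖ / 6), by positivity, fun y hy => ?_⟩
    have hyδ : ‖y - x‖ < δ₀ / 3 := lt_of_lt_of_le hy (min_le_left _ _)
    have hyx : ‖y - x‖ < ‖x‖ / 6 := lt_of_lt_of_le hy (min_le_right _ _)
    filter_upwards [hnearφ x (min (δ₀ / 3) (‖x‖ / 6)) (by positivity),
      hnearφ y (min (δ₀ / 3) (‖x‖ / 6)) (by positivity), eventually_ge_atTop (k0f (‖x‖ / 2))]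
      with k hkx hky hk0
    obtain ⟨hxS, hxd⟩ := hkx
    obtain ⟨hyS, hyd⟩ := hky
    have hxd1 : ‖x - zf (φ k) x‖ < δ₀ / 3 := lt_of_lt_of_le hxd (min_le_left _ _)
    have hxd2 : ‖x - zf (φ k) x‖ < ‖x‖ / 6 := lt_of_lt_of_le hxd (min_le_right _ _)
    have hyd1 : ‖y - zf (φ k) y‖ < δ₀ / 3 := lt_of_lt_of_le hyd (min_le_left _ _)
    have hyd2 : ‖y - zf (φ k) y‖ < ‖x‖ / 6 := lt_of_lt_of_le hyd (min_le_right _ _)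
    refine hU₀ k hk0 _ hyS _ hxS ?_ ?_ ?_
    · have h1 := norm_sub_norm_le x (zf (φ k) y)
      have h2 := norm_sub_le_norm_sub_add_norm_sub x y (zf (φ k) y)
      rw [norm_sub_rev x y] at h2
      linarith
    · have h1 := norm_sub_norm_le x (zf (φ k) x); linarith
    · have h1 := norm_sub_le_norm_sub_add_norm_sub (zf (φ k) y) y (zf (φ k) x)
      have h2 := norm_sub_le_norm_sub_add_norm_sub y x (zf (φ k) x)
      rw [norm_sub_rev (zf (φ k) y) y] at h1
      linarith
  -- hence Cauchy, hence convergent to `K x := lim`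
  have hcauchy : ∀ x : EuclideanSpace ℝ (Fin d), x ≠ 0 → CauchySeq fun k => f (φ k) (zf (φ k) x) := by
    intro x hx
    have hxpos : 0 < ‖x‖ := norm_pos_iff.mpr hx
    refine cauchySeq_of_near_convergent _ fun ε hε => ?_
    obtain ⟨δ, hδ, hδk⟩ := hkey x hx ε hε
    obtain ⟨n, hn⟩ := hdense.exists_dist_lt x (lt_min hδ (half_pos hxpos))
    have hn1 : ‖dseq n - x‖ < δ := by
      rw [← dist_eq_norm, dist_comm]; exact lt_of_lt_of_le hn (min_le_left _ _)
    have hn0 : dseq n ≠ 0 := by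
      intro h0
      have h2 : dist x (dseq n) < ‖x‖ / 2 := lt_of_lt_of_le hn (min_le_right _ _)
      rw [h0, dist_zero_right] at h2
      linarith
    refine ⟨fun k => f (φ k) (zf (φ k) (dseq n)), G n, hGn n hn0, ?_⟩
    filter_upwards [hδk (dseq n) hn1] with k hk
    rwa [abs_sub_comm] at hk
  set K : EuclideanSpace ℝ (Fin d) → ℝ := fun x => limUnder atTop (fun k => f (φ k) (zf (φ k) x)) with hK_def
  have hK : ∀ x : EuclideanSpace ℝ (Fin d), x ≠ 0 → Tendsto (fun k => f (φ k) (zf (φ k) x)) atTop (𝓝 (K x)) :=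
    fun x hx => tendsto_nhds_limUnder (cauchySeq_tendsto_of_complete (hcauchy x hx))
  -- limits of nearby reference sequences are close
  have hKclose : ∀ x : EuclideanSpace ℝ (Fin d), x ≠ 0 → ∀ ε : ℝ, 0 < ε → ∃ δ : ℝ, 0 < δ ∧
      ∀ y : EuclideanSpace ℝ (Fin d), y ≠ 0 → ‖y - x‖ < δ → |K y - K x| ≤ ε := by
    intro x hx ε hε
    obtain ⟨δ, hδ, hδk⟩ := hkey x hx ε hε
    exact ⟨δ, hδ, fun y hy hyx => abs_sub_le_of_tendsto _ _ _ _ _ (hK y hy) (hK x hx) (hδk y hyx)⟩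
  refine ⟨φ, K, hφ, ?_, ?_, ?_⟩
  · -- uniform approximation on the mesh points of an annulus
    intro η ε hη hε
    have hε3 : 0 < ε / 3 := by positivity
    obtain ⟨δ₀, hδ₀, hU₀⟩ := hU (η / 2) (by positivity) (ε / 3) hε3
    set δ : ℝ := min δ₀ η / 4 with hδ_def
    have hδpos : 0 < δ := by positivity
    have hδ1 : δ ≤ δ₀ / 4 := by
      have := min_le_left δ₀ η; simp only [hδ_def]; linarith
    have hδ2 : δ ≤ η / 4 := by
      have := min_le_right δ₀ η; simp only [hδ_def]; linarith
    -- the compact annulus and a finite `δ`-net in it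
    have hAc : IsCompact {z : EuclideanSpace ℝ (Fin d) | η ≤ ‖z‖ ∧ ‖z‖ ≤ η⁻¹} := by
      refine (isCompact_closedBall (0 : EuclideanSpace ℝ (Fin d)) η⁻¹).of_isClosed_subset ?_ ?_
      · exact (isClosed_le continuous_const continuous_norm).inter (isClosed_le continuous_norm continuous_const)
      · intro z hz; simpa [mem_closedBall, dist_zero_right] using hz.2
    obtain ⟨t, htA, htfin, hcover⟩ := finite_cover_balls_of_compact hAc hδpos
    have hct : ∀ c ∈ t, ∃ kc : ℕ, ∀ k, kc ≤ k →
        |f (φ k) (zf (φ k) c) - K c| ≤ ε / 3 ∧ (zf (φ k) c ∈ S (φ k) ∧ ‖c - zf (φ k) c‖ < δ) := by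
      intro c hc
      have hcη : η ≤ ‖c‖ := (htA hc).1
      have hc0 : c ≠ 0 := by
        intro h0; rw [h0, norm_zero] at hcη; linarith
      have h1 : ∀ᶠ k in atTop, |f (φ k) (zf (φ k) c) - K c| ≤ ε / 3 := by
        have := (Metric.tendsto_nhds.mp (hK c hc0)) (ε / 3) hε3
        exact this.mono fun k hk => by rw [Real.dist_eq] at hk; exact hk.le
      exact (h1.and (hnearφ c δ hδpos)).exists_forall_of_atTop
    choose! kc hkc using hct
    refine ⟨max (htfin.toFinset.sup kc) (k0f (η / 2)), fun k hk z hzS hzη hzη' => ?_⟩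
    have hk0 : k0f (η / 2) ≤ k := (le_max_right _ _).trans hk
    have hzA : z ∈ {z : EuclideanSpace ℝ (Fin d) | η ≤ ‖z‖ ∧ ‖z‖ ≤ η⁻¹} := ⟨hzη, hzη'⟩
    obtain ⟨c, hc, hzc⟩ := mem_iUnion₂.mp (hcover hzA)
    rw [mem_ball, dist_eq_norm] at hzc
    have hkc_le : kc c ≤ k :=
      ((Finset.le_sup (htfin.mem_toFinset.mpr hc)).trans (le_max_left _ _)).trans hk
    obtain ⟨hT2, hcS, hcd⟩ := hkc c hc k hkc_le
    have hcη : η ≤ ‖c‖ := (htA hc).1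
    have hz0 : z ≠ 0 := by
      intro h0; rw [h0, norm_zero] at hzη; linarith
    have hc0 : c ≠ 0 := by
      intro h0; rw [h0, norm_zero] at hcη; linarith
    -- T1: mesh equicontinuity between `z` and the selector of the centre
    have hT1 : |f (φ k) z - f (φ k) (zf (φ k) c)| ≤ ε / 3 := by
      refine hU₀ k hk0 z hzS _ hcS (by linarith) ?_ ?_
      · have h1 := norm_sub_norm_le c (zf (φ k) c); linarith
      · have h1 := norm_sub_le_norm_sub_add_norm_sub z c (zf (φ k) c); linarith
    -- T3: the limits at `c` and at `z` are close
    have hT3 : |K c - K z| ≤ ε / 3 := by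
      refine abs_sub_le_of_tendsto _ _ _ _ _ (hK c hc0) (hK z hz0) ?_
      filter_upwards [hnearφ c δ hδpos, hnearφ z δ hδpos, eventually_ge_atTop (k0f (η / 2))]
        with j hjc hjz hj0
      obtain ⟨hcS', hcd'⟩ := hjc
      obtain ⟨hzS', hzd'⟩ := hjz
      refine hU₀ j hj0 _ hcS' _ hzS' ?_ ?_ ?_
      · have h1 := norm_sub_norm_le c (zf (φ j) c); linarith
      · have h1 := norm_sub_norm_le z (zf (φ j) z); linarith
      · have h1 := norm_sub_le_norm_sub_add_norm_sub (zf (φ j) c) c (zf (φ j) z)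
        have h2 := norm_sub_le_norm_sub_add_norm_sub c z (zf (φ j) z)
        rw [norm_sub_rev (zf (φ j) c) c] at h1
        rw [norm_sub_rev c z] at h2
        linarith
    calc |f (φ k) z - K z|
        = |(f (φ k) z - f (φ k) (zf (φ k) c)) + (f (φ k) (zf (φ k) c) - K c) + (K c - K z)| := by ring_nf
      _ ≤ |f (φ k) z - f (φ k) (zf (φ k) c)| + |f (φ k) (zf (φ k) c) - K c| + |K c - K z| :=
          abs_add_three _ _ _
      _ ≤ ε / 3 + ε / 3 + ε / 3 := by gcongr
      _ = ε := by ring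
  · -- continuity off the origin
    intro x hx
    have hx' : x ≠ 0 := hx
    have hxpos : 0 < ‖x‖ := norm_pos_iff.mpr hx'
    refine ContinuousAt.continuousWithinAt (Metric.continuousAt_iff.mpr fun ε hε => ?_)
    obtain ⟨δ, hδ, hδK⟩ := hKclose x hx' (ε / 2) (half_pos hε)
    refine ⟨min δ (‖x‖ / 2), by positivity, fun y hy => ?_⟩
    rw [dist_eq_norm] at hy
    have hy0 : y ≠ 0 := by
      intro h0
      have h2 : ‖y - x‖ < ‖x‖ / 2 := lt_of_lt_of_le hy (min_le_right _ _)
      rw [h0, zero_sub, norm_neg] at h2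
      linarith
    rw [Real.dist_eq]
    exact (hδK y hy0 (lt_of_lt_of_le hy (min_le_left _ _))).trans_lt (half_lt_self hε)
  · -- boundedness on exterior regions
    intro η hη
    refine ⟨Cf (η / 2), fun z hz => ?_⟩
    have hz0 : z ≠ 0 := by
      intro h0; rw [h0, norm_zero] at hz; linarith
    refine abs_le_of_tendsto _ _ _ (hK z hz0) ?_
    filter_upwards [hnearφ z (η / 2) (half_pos hη), eventually_ge_atTop (k0f (η / 2))] with k hk hk0
    obtain ⟨hzS, hzd⟩ := hk
    refine ((hTf (η / 2) (half_pos hη)) (φ k) (hk0.trans (hφk k)) _ hzS ?_).1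
    have h1 := norm_sub_norm_le z (zf (φ k) z); linarith

/-- **Indexed form** of `meshArzelaAscoli`, matching the binder shape of `LimitExtraction`: the meshes are images
`e k '' P k` of index sets (lattice sites `z ∈ box 4 L` under `z ↦ a • siteToE z`, injective since `a > 0`) and the
values are indexed functions `g k i` (the rescaled lattice kernels). -/
theorem meshArzelaAscoli_indexed (d : ℕ) {ι : Type*} (P : ℕ → Set ι)
    (e : ℕ → ι → EuclideanSpace ℝ (Fin d)) (g : ℕ → ι → ℝ) (he : ∀ k, Set.InjOn (e k) (P k))
    (hT : ∀ η : ℝ, 0 < η → ∃ (C : ℝ) (ω : ℝ → ℝ) (k₀ : ℕ), Tendsto ω (𝓝[>] 0) (𝓝 0) ∧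
      ∀ k, k₀ ≤ k → ∀ i ∈ P k, η ≤ ‖e k i‖ →
        |g k i| ≤ C ∧ ∀ i' ∈ P k, η ≤ ‖e k i'‖ → |g k i - g k i'| ≤ ω ‖e k i - e k i'‖)
    (hD : ∀ δ R : ℝ, 0 < δ → 0 < R → ∃ k₀ : ℕ, ∀ k, k₀ ≤ k →
      ∀ x : EuclideanSpace ℝ (Fin d), ‖x‖ ≤ R → ∃ i ∈ P k, ‖x - e k i‖ ≤ δ) :
    ∃ (φ : ℕ → ℕ) (K : EuclideanSpace ℝ (Fin d) → ℝ), StrictMono φ ∧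
      (∀ η ε : ℝ, 0 < η → 0 < ε → ∃ k₀ : ℕ, ∀ k, k₀ ≤ k → ∀ i ∈ P (φ k), η ≤ ‖e (φ k) i‖ →
        ‖e (φ k) i‖ ≤ η⁻¹ → |g (φ k) i - K (e (φ k) i)| ≤ ε) ∧
      ContinuousOn K {z | z ≠ 0} ∧
      (∀ η : ℝ, 0 < η → ∃ C : ℝ, ∀ z : EuclideanSpace ℝ (Fin d), η ≤ ‖z‖ → |K z| ≤ C) := by
  classical
  -- the index type is nonempty (the meshes are eventually nonempty)
  obtain ⟨k₀', hk₀'⟩ := hD 1 1 one_pos one_pos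
  obtain ⟨i₀, -, -⟩ := hk₀' k₀' le_rfl 0 (by simp)
  haveI : Nonempty ι := ⟨i₀⟩
  -- transfer to functions on the image meshes
  have hval : ∀ k, ∀ i ∈ P k, g k (Function.invFunOn (e k) (P k) (e k i)) = g k i :=
    fun k i hi => by rw [(he k).leftInvOn_invFunOn hi]
  obtain ⟨φ, K, hφ, happrox, hcont, hbound⟩ := meshArzelaAscoli d (fun k => e k '' P k)
    (fun k x => g k (Function.invFunOn (e k) (P k) x)) (by
      intro η hη
      obtain ⟨C, ω, k₀, hω, hk⟩ := hT η hη
      refine ⟨C, ω, k₀, hω, fun k hk0 z hz hzη => ?_⟩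
      obtain ⟨i, hi, rfl⟩ := hz
      obtain ⟨h1, h2⟩ := hk k hk0 i hi hzη
      refine ⟨by rwa [hval k i hi], fun z' hz' hz'η => ?_⟩
      obtain ⟨i', hi', rfl⟩ := hz'
      rw [hval k i hi, hval k i' hi']
      exact h2 i' hi' hz'η) (by
      intro δ R hδ hR
      obtain ⟨k₀, hk₀⟩ := hD δ R hδ hR
      refine ⟨k₀, fun k hk x hx => ?_⟩
      obtain ⟨i, hi, hxi⟩ := hk₀ k hk x hx
      exact ⟨e k i, ⟨i, hi, rfl⟩, hxi⟩)
  refine ⟨φ, K, hφ, fun η ε hη hε => ?_, hcont, hbound⟩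
  obtain ⟨k₀, hk₀⟩ := happrox η ε hη hε
  refine ⟨k₀, fun k hk i hi h1 h2 => ?_⟩
  have := hk₀ k hk (e (φ k) i) ⟨i, hi, rfl⟩ h1 h2
  rwa [hval (φ k) i hi] at this

end Summit.QuantumFields.YangMills.Cruxes.UniversalDetectorLimitExtraction
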